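import Summits.BirchSwinnertonDyer.Rank1Residual.GaloisImage.IrreducibleModThreeCentralInvolution
import HarnessLib

/-!
# `−1 ∈ ρ_{E,3ⁿ}(Γ_ℚ)` at EVERY level `3ⁿ` for every `E/ℚ` with `E[3]` irreducible, and Sakamoto's
# (H.3) at every level `3^{k+1}` (cell `bsd-stepL`, seat `bsd-stepL-shim3b` g2; helper for the crux
# `ShimuraKolyvaginOrderBoundAtThreeSurj` = item stmt-BirchSwinnertonDyer-19899, ex 19616)

HONEST FRAMING (programme file §HONESTY, verbatim): «no tranche here proves BSD; ARM L moves the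
LITERAL column of an r ≤ 1 census into the kernel-proved-modulo-named-print column; ARM P changes what
«named print» is worth. The residue (4.31 %) and every SUMMIT-BEARING rung (S0–S3) stay theorem-bound
and are staffed by the 22 routes, not by this programme.» THEOREMS ONLY (no definition, no named fact,
no `sorry`); nothing here is a BSD class theorem; no census label moves.

## Why this file exists

The D7-restated crux `ShimuraKolyvaginOrderBoundAtThreeSurj` (Kolyvagin's ORDER bound for the
Shimura–Heegner point of `X_{N⁺,N⁻}` at `p = 3 ∣ N⁺`, `ρ̄_{E,3}` onto) was given a two-piece skeleton
cut by the 3-ADIC image (`HOME/plan/D7`, stubs `…adicOntoAtThree` / `…adicDefectAtThree` = the Elkies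
locus, mod 3 onto but not mod 9), on the ground that off the `GL₂(ℤ₃)`-image «the vanishing of
`H¹(K(E[3ⁿ])/K, E[3ⁿ])` … must be redone for that specific 3-adic image». This file proves, in the
kernel, the group-theoretic reason why no such re-doing is needed, uniformly in the 3-adic image and
even in the mod-3 image (surjective or not, as long as `E[3]` is irreducible):

* §1 `smul_pow_three_pow_eq_neg` — pure algebra: if an element `z` of a monoid acting distributively
  on an abelian group `A` acts as `−1` on the `3`-torsion, then `z^{3ⁿ}` acts as `−1` on the
  `3^{n+1}`-torsion (induction: with `w = z^{3ⁿ}` and `a` killed by `3^{n+2}`, `R := w•a + a` is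
  `3`-torsion, `w•R = −R`, and `w³•a = 3R − a = −a`). No freeness, no matrices.
* §2 **`exists_smul_eq_neg_three_pow_of_irr`** — `E[3]` irreducible ⟹ for every `n`, some
  `z ∈ Γ_ℚ` acts as `−1` on `E[3^{n+1}]` (from the level-one theorem
  `GaloisImage.exists_smul_eq_neg_three_of_irr`, part 11c, and §1). This is the statement
  «`−1 ∈ ρ̄_{E,9}(Γ_ℚ)`, …, any level `3^{k+1}`» that part 11c lists as NOT claimed there.
* §3 **`hH3_three_pow_of_irr`** — Sakamoto's (H.3) at level `3^{k+1}` with coefficients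
  `T̄ = E[3^{m+1}]`, for EVERY `E/ℚ` with `E[3]` irreducible and all `k, m`: every continuous crossed
  homomorphism `Γ_ℚ → E[3^{m+1}]` vanishing on `ker ρ̄_{E,3^{k+1}} ∩ Gal(ℚ̄/ℚ(μ_{3^{k+1}}))` is
  principal (the tree's inflation–restriction engine `InflRes.h3_of_commute` with the central
  element of §2: `−1 − 1 = −2` is invertible on odd torsion, `InflRes.bijective_rho_sub_self_of_eq_neg`).

Reading for the crux (recorded, not asserted by any `def`): with `z` central acting as `−1`, Sah's
lemma kills `H^i(Gal(L/F), E[3^{m}])` for every Galois `L/F` through which `ρ_{E,3^{n}}∣_{Γ_F}`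
factors and every `i` — the hypothesis (a) of Matar–Nekovář 2019 Thm 0.3 (= Kolyvagin 1990 Cor. 13)
and the input of Cha 2005 Lemma 23 / McCallum 1991 §5 — with NO condition on the 3-adic image
(Matar–Nekovář Cor. 5.21 (e′) + Prop. 5.26 (2) print the same for `F = K` imaginary quadratic,
`(d_K, 3N) = 1`, any odd `p`). The passage from `Γ_ℚ` to `Γ_K` (linear disjointness of `K` and
`ℚ(E[3ⁿ])`) is not formalised here.

References: [Serre1972] §2.4 Prop. 15, §2.5; [Sakamoto2024] R. Sakamoto, JTNB 36 (2024) §2 (H.3);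
[MazurRubin2004] Lemma 3.5.2; [MatarNekovar2019] Cor. 5.21 (e′), Prop. 5.26 (2) (pp. 490–492);
[Cha2005] Thm. 2, Lemmas 22–23 (pp. 155, 174–175); C.-H. Sah, J. Algebra 10 (1968).
-/

set_option autoImplicit false

set_option linter.dupNamespace false -- the Theorems namespace repeats the summit name, as in every sibling

noncomputable section

open scoped Classical

open Field WeierstrassCurve
  Literature.NumberTheory.EllipticCurves Literature.NumberTheory.GaloisRepresentations
  Literature.NumberTheory.EllipticCurves.Rank1Residual
  Summit.BirchSwinnertonDyer.Rank1Residual.GaloisImage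

namespace Summit.BirchSwinnertonDyer.BirchSwinnertonDyer.Theorems.ShimuraKolyvaginMinusOne

/-! ## §1. Pure algebra: `−1` on the `3`-torsion ⟹ `−1` on the `3^{n+1}`-torsion after raising to `3ⁿ` -/

section Algebra

variable {G A : Type*} [Monoid G] [AddCommGroup A] [DistribMulAction G A]

/-- If `z` acts as `−1` on an element `R`, so does every odd power of `z`. [folklore] -/
theorem pow_smul_eq_neg_of_odd (z : G) {R : A} (hR : z • R = -R) {m : ℕ} (hm : Odd m) :
    z ^ m • R = -R := by
  have h2 : z ^ 2 • R = R := by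
    rw [pow_two, mul_smul, hR, smul_neg, hR, neg_neg]
  obtain ⟨j, rfl⟩ := hm
  induction j with
  | zero => simpa using hR
  | succ j ih =>
    rw [show 2 * (j + 1) + 1 = 2 + (2 * j + 1) by ring, pow_add, mul_smul, ih, smul_neg, h2]

/-- **Level raising for a central `−1`.** If `z` acts as `−1` on the `3`-torsion of `A`, then
`z^{3ⁿ}` acts as `−1` on the `3^{n+1}`-torsion of `A`. Proof by induction on `n`: for `a` with
`3^{n+2} a = 0` put `w = z^{3ⁿ}` and `R = w a + a`; then `3R = w(3a) + 3a = 0` (induction hypothesis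
on `3a`), so `wR = −R` (`3ⁿ` odd), and `w³a = w²(R − a) = … = 3R − a = −a`. [folklore] -/
theorem smul_pow_three_pow_eq_neg (z : G) (hz : ∀ a : A, (3 : ℕ) • a = 0 → z • a = -a) :
    ∀ (n : ℕ) (a : A), (3 ^ (n + 1) : ℕ) • a = 0 → z ^ (3 ^ n) • a = -a := by
  intro n
  induction n with
  | zero =>
    intro a ha
    rw [pow_zero, pow_one]
    exact hz a (by simpa using ha)
  | succ n ih =>
    intro a ha
    set w : G := z ^ (3 ^ n) with hw
    -- `3 • a` is `3^{n+1}`-torsion, so `w` acts as `−1` on it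
    have h3a : (3 ^ (n + 1) : ℕ) • ((3 : ℕ) • a) = 0 := by
      rw [← mul_smul, ← pow_succ]
      exact ha
    have hw3a : w • ((3 : ℕ) • a) = -((3 : ℕ) • a) := ih _ h3a
    -- `R := w • a + a` is `3`-torsion
    set R : A := w • a + a with hR
    have hR3 : (3 : ℕ) • R = 0 := by
      rw [hR, smul_add, ← smul_comm w (3 : ℕ) a, hw3a, neg_add_cancel]
    have hzR : z • R = -R := hz R hR3
    have hwR : w • R = -R :=
      pow_smul_eq_neg_of_odd z hzR (Odd.pow (by decide : Odd 3))
    -- `w³ • a = −a`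
    have h1 : w • a = R - a := by rw [hR]; abel
    have h2 : w • (w • a) = a - R - R := by
      rw [h1, smul_sub, hwR, h1]; abel
    have h3 : w • (w • (w • a)) = -a := by
      rw [h2, smul_sub, smul_sub, h1, hwR]
      have : (3 : ℕ) • R = R + R + R := by
        rw [show (3 : ℕ) = 1 + 1 + 1 by rfl, add_nsmul, add_nsmul, one_nsmul]
      rw [this] at hR3
      -- R - a - (-R) - (-R) = 3R - a = -a
      have : R - a - -R - -R = (R + R + R) - a := by abel
      rw [this, hR3, zero_sub]
    calc z ^ 3 ^ (n + 1) • a = (w * (w * w)) • a := by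
          rw [hw, ← pow_add, ← pow_add, pow_succ]
          congr 1
          ring
      _ = -a := by rw [mul_smul, mul_smul, h3]

end Algebra

/-! ## §2. `E[3]` irreducible ⟹ `−1 ∈ ρ_{E,3^{n+1}}(Γ_ℚ)` for every `n` -/

section Levels

variable (W : WeierstrassCurve ℚ)

/-- Membership in the geometric `n`-torsion as an `ℕ`-scalar identity (`n : ℕ`). [folklore] -/
theorem natCast_smul_coe_eq_zero {n : ℕ} (P : geomTorsion W ((n : ℕ) : ℤ)) :
    (n : ℕ) • (P : geomPoints W) = 0 := by
  have h : ((n : ℕ) : ℤ) • (P : geomPoints W) = 0 := (Submodule.mem_torsionBy_iff _ _).mp P.2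
  rwa [natCast_zsmul] at h

/-- A geometric point killed by `n : ℕ` lies in the geometric `n`-torsion. [folklore] -/
theorem mem_geomTorsion_of_smul_eq_zero {n : ℕ} {a : geomPoints W} (ha : (n : ℕ) • a = 0) :
    a ∈ geomTorsion W ((n : ℕ) : ℤ) := by
  refine (Submodule.mem_torsionBy_iff _ _).mpr ?_
  rw [natCast_zsmul]
  exact ha

/-- If `z ∈ Γ_ℚ` acts as `−1` on `E[n]` then it acts as `−1` on every geometric point killed by
`n`. [folklore] -/
theorem smul_eq_neg_of_forall_geomTorsion {n : ℕ} (z : absoluteGaloisGroup ℚ)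
    (hz : ∀ P : geomTorsion W ((n : ℕ) : ℤ), z • P = -P) (a : geomPoints W) (ha : (n : ℕ) • a = 0) :
    z • a = -a := by
  have h := congrArg Subtype.val (hz ⟨a, mem_geomTorsion_of_smul_eq_zero W ha⟩)
  simpa only [AddSubgroup.torsionBy.coe_smul, NegMemClass.coe_neg] using h

/-- If `z ∈ Γ_ℚ` acts as `−1` on `E[3^{L+1}]` then it acts as `−1` on `E[3^{j+1}]` for `j ≤ L`.
[folklore] -/
theorem smul_eq_neg_of_le (z : absoluteGaloisGroup ℚ) {L j : ℕ} (hjL : j ≤ L)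
    (hz : ∀ P : geomTorsion W ((3 ^ (L + 1) : ℕ) : ℤ), z • P = -P)
    (P : geomTorsion W ((3 ^ (j + 1) : ℕ) : ℤ)) : z • P = -P := by
  apply Subtype.ext
  rw [AddSubgroup.torsionBy.coe_smul, NegMemClass.coe_neg]
  refine smul_eq_neg_of_forall_geomTorsion W z hz (P : geomPoints W) ?_
  obtain ⟨d, hd⟩ : 3 ^ (j + 1) ∣ 3 ^ (L + 1) := pow_dvd_pow 3 (by omega)
  rw [hd, mul_comm, mul_smul, natCast_smul_coe_eq_zero W P, smul_zero]

/-- **`E[3]` irreducible ⟹ `−1 ∈ ρ_{E,3^{n+1}}(Γ_ℚ)` for every `n`**: some `z ∈ Γ_ℚ` acts as `−1`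
on `E[3^{n+1}]`. From the level-one theorem (`GaloisImage.exists_smul_eq_neg_three_of_irr`: a
non-trivial `2`-group image has a central involution, which is `−1`; onto: `−1 ∈ GL₂(𝔽₃)`) and the
level raising of §1 applied to `z^{3ⁿ}`. In particular `−1 ∈ ρ̄_{E,9}(Γ_ℚ)` and, `3`-adically,
`−1 ∈ ρ_{E,3^∞}(Γ_ℚ)` — for EVERY 3-adic image with irreducible reduction (the Elkies locus
included). [cite: Serre1972, §2.4 Prop. 15 and §2.5] -/
theorem exists_smul_eq_neg_three_pow_of_irr [W.IsElliptic] [Fact (Nat.Prime 3)] (hirr : Irr W 3) (n : ℕ) :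
    ∃ z : absoluteGaloisGroup ℚ, ∀ P : geomTorsion W ((3 ^ (n + 1) : ℕ) : ℤ), z • P = -P := by
  obtain ⟨z, hz⟩ := exists_smul_eq_neg_three_of_irr W hirr
  refine ⟨z ^ (3 ^ n), fun P => ?_⟩
  have hz' : ∀ a : geomPoints W, (3 : ℕ) • a = 0 → z • a = -a :=
    fun a ha => smul_eq_neg_of_forall_geomTorsion W z hz a ha
  apply Subtype.ext
  rw [AddSubgroup.torsionBy.coe_smul, NegMemClass.coe_neg]
  exact smul_pow_three_pow_eq_neg z hz' n (P : geomPoints W) (natCast_smul_coe_eq_zero W P)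

/-! ## §3. Sakamoto's (H.3) at every level `3^{k+1}` on every irreducible row -/

/-- **(H.3) at level `3^{k+1}`, coefficients `E[3^{m+1}]`, for EVERY `E/ℚ` with `E[3]` irreducible**:
every continuous crossed homomorphism `f : Γ_ℚ → E[3^{m+1}]` vanishing on
`ker ρ̄_{E,3^{k+1}} ∩ Gal(ℚ̄/ℚ(μ_{3^{k+1}}))` is principal. The element `z` of §2 at level
`3^{k+m+1}` is central in both images (it IS `−1` there) and `x ↦ z x − x = −2x` is bijective on the
odd-torsion group `E[3^{m+1}]`; the tree's engine `InflRes.h3_of_commute` does the rest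
(commutators `[g, z]` lie in the displayed subgroup). This is the hypothesis (H.3) of Sakamoto's
structure theorem for Kolyvagin systems over `ℤ/3^{k+1}` (tree fact
`Sakamoto2024.kolyvaginSystems_freeRankOne_zmod_three_pow`) at every level, with no surjectivity and
no 3-adic image condition. [cite: Sakamoto2024, §2 (H.3)] [cite: MazurRubin2004, Lemma 3.5.2]
[cite: Serre1972, §2.4 Prop. 15] -/
theorem hH3_three_pow_of_irr [W.IsElliptic] [Fact (Nat.Prime 3)] (hirr : Irr W 3) (k m : ℕ)
    (f : contOneCocycles (W.torsionGaloisModule ((3 ^ (m + 1) : ℕ) : ℤ)).toTopRep)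
    (hf : ∀ u : absoluteGaloisGroup ℚ, (W.torsionGaloisModule ((3 ^ (k + 1) : ℕ) : ℤ)) u = 1 →
        u ∈ rootsOfUnityFixer ℚ (3 ^ (k + 1)) → f.1 u = 0) :
    oneCocycleClass (W.torsionGaloisModule ((3 ^ (m + 1) : ℕ) : ℤ)).toTopRep f = 0 := by
  obtain ⟨z, hz⟩ := exists_smul_eq_neg_three_pow_of_irr W hirr (k + m)
  have hzk : ∀ P : geomTorsion W ((3 ^ (k + 1) : ℕ) : ℤ), z • P = -P :=
    smul_eq_neg_of_le W z (by omega) hz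
  have hzm : ∀ P : geomTorsion W ((3 ^ (m + 1) : ℕ) : ℤ), z • P = -P :=
    smul_eq_neg_of_le W z (by omega) hz
  have h30 : (3 ^ (k + 1) : ℕ) ≠ 0 := pow_ne_zero _ (by norm_num)
  haveI : NeZero (3 ^ (k + 1) : ℕ) := ⟨h30⟩
  haveI : NeZero ((3 ^ (k + 1) : ℕ) : ℚ) := ⟨Nat.cast_ne_zero.mpr h30⟩
  have hρk : (W.torsionGaloisModule ((3 ^ (k + 1) : ℕ) : ℤ)) z = -1 :=
    LinearMap.ext fun x => by rw [torsionGaloisModule_apply_apply, hzk]; rfl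
  have hρm : (W.torsionGaloisModule ((3 ^ (m + 1) : ℕ) : ℤ)) z = -1 :=
    LinearMap.ext fun x => by rw [torsionGaloisModule_apply_apply, hzm]; rfl
  have htors : ∀ x : geomTorsion W ((3 ^ (m + 1) : ℕ) : ℤ), (3 ^ (m + 1)) • x = 0 := fun x => by
    apply Subtype.ext
    rw [AddSubmonoidClass.coe_nsmul, ZeroMemClass.coe_zero]
    exact natCast_smul_coe_eq_zero W x
  refine InflRes.h3_of_commute (W.torsionGaloisModule ((3 ^ (k + 1) : ℕ) : ℤ))
    (W.torsionGaloisModule ((3 ^ (m + 1) : ℕ) : ℤ)) (3 ^ (k + 1)) z ?_ ?_ ?_ f hf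
  · intro g
    rw [hρk]
    exact Commute.neg_one_right _
  · intro g
    rw [hρm]
    exact Commute.neg_one_right _
  · exact InflRes.bijective_rho_sub_self_of_eq_neg
      (W.torsionGaloisModule ((3 ^ (m + 1) : ℕ) : ℤ)).toTopRep z
      (fun x => by change z • x = -x; exact hzm x) (3 ^ (m + 1))
      (Odd.pow (by decide : Odd 3)) htors

/-- **(H.3) at level `3^{k+1}` with `T = T̄ = E[3^{k+1}]`** (the shape used by Sakamoto's theorem),
for every `E/ℚ` with `E[3]` irreducible. [cite: Sakamoto2024, §2 (H.3)] -/
theorem hH3_self_three_pow_of_irr [W.IsElliptic] [Fact (Nat.Prime 3)] (hirr : Irr W 3) (k : ℕ)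
    (f : contOneCocycles (W.torsionGaloisModule ((3 ^ (k + 1) : ℕ) : ℤ)).toTopRep)
    (hf : ∀ u : absoluteGaloisGroup ℚ, (W.torsionGaloisModule ((3 ^ (k + 1) : ℕ) : ℤ)) u = 1 →
        u ∈ rootsOfUnityFixer ℚ (3 ^ (k + 1)) → f.1 u = 0) :
    oneCocycleClass (W.torsionGaloisModule ((3 ^ (k + 1) : ℕ) : ℤ)).toTopRep f = 0 :=
  hH3_three_pow_of_irr W hirr k k f hf

end Levels

end Summit.BirchSwinnertonDyer.BirchSwinnertonDyer.Theorems.ShimuraKolyvaginMinusOne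

end
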